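import Mathlib
import HarnessLib
import Summits.Ventures.LatticeQCDFlow.Exactness.IMHCrossReplicaProposalExact
import Summits.Ventures.LatticeQCDFlow.Exactness.RefreshScan

/-!
# Mutually trained flow samplers converge JOINTLY: if every fitted flow has weights bounded by `W` (replica 1) and `W'` (replica 2), one sweep of
# the cross-replica scheme dominates `(WW')⁻¹·(π ⊗ π)` from every pair of states, so the pair converges to `π ⊗ π` at rate `(1 − 1/(WW'))ᵗ`

HONEST FRAMING: exact (Metropolis-corrected) sampling algorithms for lattice gauge theory;
figures of merit are autocorrelation/cost numbers at stated couplings and volumes; no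
continuum-physics claim.

Venture `LatticeQCDFlow` (cell pub-lqcd), topic `Exactness`; FANOUT row 30 (lean-1, GEN-42).  NEW WORK of the cell, the quantitative companion of
this generation's `IMHCrossReplicaProposalExact` (exactness of block updates whose kernel is fitted on the other block), over Mathlib and the
tree (`IMHKernel.indepMH_apply_ge`: a weight bound `w ≤ W` gives the Doeblin minorisation `W⁻¹·π ≤ indepMH q w (x, ·)`; `RefreshScan.
uniformlyErgodic_of_minorised`).  DEF-FREE as there: `L(x, y) = K(x, y) ⊗ δ_y`, `M(x, y) = δ_x ⊗ K'(x, y)`, one sweep `M ∘ₖ L`.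

## Results (no `sorry`, no new definitions)
* §1 MINORISATIONS COMPOSE ACROSS BLOCKS (general `X × Y`): `blockUpdate_fst_lintegral_ge` (`ε•π ≤ K(·, y)` for all fibres ⇒
  `∫ g(x') L((x, y), d(x', y')) ≥ ε ∫ g dπ` for every measurable `g ≥ 0` of the first block), `blockUpdate_snd_apply_ge`
  (`ε'•π' ≤ K'(x, ·)` ⇒ `M((x, y), S) ≥ ε'·π'(S_x)`), **`blockUpdate_sweep_minorised`** — `(M ∘ₖ L)(z, S) ≥ εε'·(π ⊗ π')(S)` for every state `z`
  and measurable `S`; `blockUpdate_sweep_smul_le` (the measure form); **`blockUpdate_sweep_uniformlyErgodic`** — with the fibrewise invariances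
  of `IMHCrossReplicaProposalExact`: `|μ₀(M∘ₖL)ᵗ(S) − (π ⊗ π')(S)| ≤ (1 − εε')ᵗ` from EVERY initial law of the pair.
* §2 THE FLOW INSTANCE: `indepMH_smul_le` (`(W)⁻¹•π ≤ indepMH q w (x, ·)` as measures for `w ≤ W`), **`crossReplica_sweep_uniformlyErgodic`** —
  two replicas, each updated by an independence sampler whose flow is fitted on the OTHER replica's current state, with all fitted weights
  bounded (`w_y ≤ W`, `w'_x ≤ W'`): `|μ₀(M∘ₖL)ᵗ(S) − (π ⊗ π)(S)| ≤ (1 − (WW')⁻¹)ᵗ` for every measurable `S ⊆ Ω × Ω` and every initial law.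
Reading (gauge files): conditioning each member's flow on the other members keeps not only exactness but the worst-case rate — a sweep of the
mutually trained pair contracts total variation to the product Wilson law by `1 − 1/(WW')`, the product of the two single-replica Doeblin
constants; whatever the cross-training gains shows up in `W`, `W'` themselves.  NOT CLAIMED: that cross-training improves `W`; rates for unbounded
weights; more than two blocks (the `R`-replica sweep composes the same way, one factor per block).
-/

noncomputable section

namespace Summit.Ventures.LatticeQCDFlow.Exactness

open MeasureTheory ProbabilityTheory
open scoped ENNReal

variable {X Y : Type*} [MeasurableSpace X] [MeasurableSpace Y]

/-! ## §1 Minorisations compose across the two blocks -/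

/-- First block: a fibrewise minorisation `ε•π ≤ K(·, y)` passes to integrals of functions of the first coordinate against `L = K ⊗ δ`:
`ε·∫ g dπ ≤ ∫ g(x') L(z, d(x', y'))`. [ours] -/
theorem blockUpdate_fst_lintegral_ge (K : Kernel (X × Y) X) [IsMarkovKernel K] (π : Measure X) {ε : ℝ≥0∞} (hK : ∀ z, ε • π ≤ K z)
    (L : Kernel (X × Y) (X × Y)) (hL : ∀ z, L z = (K z).prod (Measure.dirac z.2)) (z : X × Y) {g : X → ℝ≥0∞} (hg : Measurable g) :
    ε * ∫⁻ x, g x ∂π ≤ ∫⁻ p, g p.1 ∂(L z) := by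
  rw [hL z, Measure.prod_dirac, lintegral_map (show Measurable fun p : X × Y => g p.1 from hg.comp measurable_fst) measurable_prodMk_right]
  calc ε * ∫⁻ x, g x ∂π = ∫⁻ x, g x ∂(ε • π) := by rw [lintegral_smul_measure, smul_eq_mul]
    _ ≤ ∫⁻ x, g x ∂(K z) := lintegral_mono' (hK z) le_rfl

/-- Second block: `ε'•π' ≤ K'(z)` gives `M(z, S) ≥ ε'·π'({y' | (z.1, y') ∈ S})`. [ours] -/
theorem blockUpdate_snd_apply_ge (K' : Kernel (X × Y) Y) [IsMarkovKernel K'] (π' : Measure Y) {ε' : ℝ≥0∞} (hK' : ∀ z, ε' • π' ≤ K' z)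
    (M : Kernel (X × Y) (X × Y)) (hM : ∀ z, M z = (Measure.dirac z.1).prod (K' z)) (z : X × Y) {S : Set (X × Y)} (hS : MeasurableSet S) :
    ε' * π' (Prod.mk z.1 ⁻¹' S) ≤ M z S := by
  rw [blockUpdate_snd_apply K' M hM z hS]
  have h := Measure.le_iff.1 (hK' z) (Prod.mk z.1 ⁻¹' S) (measurable_prodMk_left (x := z.1) hS)
  rw [Measure.smul_apply, smul_eq_mul] at h
  exact h

/-- **ONE SWEEP DOMINATES `εε'·(π ⊗ π')`**: `(M ∘ₖ L)(z, S) ≥ εε'·(π ⊗ π')(S)` for every state `z` and measurable `S`. [ours] -/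
theorem blockUpdate_sweep_minorised (K : Kernel (X × Y) X) [IsMarkovKernel K] (K' : Kernel (X × Y) Y) [IsMarkovKernel K']
    (π : Measure X) [SFinite π] (π' : Measure Y) [SFinite π'] {ε ε' : ℝ≥0∞} (hK : ∀ z, ε • π ≤ K z) (hK' : ∀ z, ε' • π' ≤ K' z)
    (L M : Kernel (X × Y) (X × Y)) (hL : ∀ z, L z = (K z).prod (Measure.dirac z.2)) (hM : ∀ z, M z = (Measure.dirac z.1).prod (K' z))
    (z : X × Y) {S : Set (X × Y)} (hS : MeasurableSet S) :
    ε * ε' * (π.prod π') S ≤ (M ∘ₖ L) z S := by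
  rw [Kernel.comp_apply' _ _ _ hS, Measure.prod_apply hS]
  have hg : Measurable fun x : X => π' (Prod.mk x ⁻¹' S) := measurable_measure_prodMk_left hS
  calc ε * ε' * ∫⁻ x, π' (Prod.mk x ⁻¹' S) ∂π = ε' * (ε * ∫⁻ x, π' (Prod.mk x ⁻¹' S) ∂π) := by ring
    _ ≤ ε' * ∫⁻ p, π' (Prod.mk p.1 ⁻¹' S) ∂(L z) := mul_le_mul' le_rfl (blockUpdate_fst_lintegral_ge K π hK L hL z hg)
    _ = ∫⁻ p, ε' * π' (Prod.mk p.1 ⁻¹' S) ∂(L z) := (lintegral_const_mul _ (hg.comp measurable_fst)).symm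
    _ ≤ ∫⁻ p, M p S ∂(L z) := lintegral_mono fun p => blockUpdate_snd_apply_ge K' π' hK' M hM p hS

/-- The measure form: `εε' • (π ⊗ π') ≤ (M ∘ₖ L)(z)` for every `z`. [ours] -/
theorem blockUpdate_sweep_smul_le (K : Kernel (X × Y) X) [IsMarkovKernel K] (K' : Kernel (X × Y) Y) [IsMarkovKernel K']
    (π : Measure X) [SFinite π] (π' : Measure Y) [SFinite π'] {ε ε' : ℝ≥0∞} (hK : ∀ z, ε • π ≤ K z) (hK' : ∀ z, ε' • π' ≤ K' z)
    (L M : Kernel (X × Y) (X × Y)) (hL : ∀ z, L z = (K z).prod (Measure.dirac z.2)) (hM : ∀ z, M z = (Measure.dirac z.1).prod (K' z))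
    (z : X × Y) : (ε * ε') • (π.prod π') ≤ (M ∘ₖ L) z := by
  rw [Measure.le_iff]
  intro S hS
  rw [Measure.smul_apply, smul_eq_mul]
  exact blockUpdate_sweep_minorised K K' π π' hK hK' L M hL hM z hS

/-- **JOINT UNIFORM ERGODICITY OF THE TWO-BLOCK SWEEP**: fibrewise invariance (as in `IMHCrossReplicaProposalExact`) plus fibrewise minorisations
`ε•π ≤ K(·, y)`, `ε'•π' ≤ K'(x, ·)` give `|μ₀(M∘ₖL)ᵗ(S) − (π ⊗ π')(S)| ≤ (1 − εε')ᵗ` from every initial law `μ₀` of the pair. [ours] -/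
theorem blockUpdate_sweep_uniformlyErgodic (K : Kernel (X × Y) X) [IsMarkovKernel K] (K' : Kernel (X × Y) Y) [IsMarkovKernel K']
    (π : Measure X) [IsProbabilityMeasure π] (π' : Measure Y) [IsProbabilityMeasure π'] {ε ε' : ℝ≥0∞}
    (hK : ∀ z, ε • π ≤ K z) (hK' : ∀ z, ε' • π' ≤ K' z)
    (hKinv : ∀ y, ∀ ⦃A : Set X⦄, MeasurableSet A → ∫⁻ x, K (x, y) A ∂π = π A)
    (hK'inv : ∀ x, ∀ ⦃B : Set Y⦄, MeasurableSet B → ∫⁻ y, K' (x, y) B ∂π' = π' B)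
    (L M : Kernel (X × Y) (X × Y)) (hL : ∀ z, L z = (K z).prod (Measure.dirac z.2)) (hM : ∀ z, M z = (Measure.dirac z.1).prod (K' z))
    (μ₀ : Measure (X × Y)) [IsProbabilityMeasure μ₀] (t : ℕ) (S : Set (X × Y)) :
    |((fun ν : Measure (X × Y) => ν.bind (M ∘ₖ L))^[t] μ₀).real S - (π.prod π').real S| ≤ (1 - (ε * ε').toReal) ^ t := by
  haveI : IsMarkovKernel L := ⟨fun z => by rw [hL z]; infer_instance⟩
  haveI : IsMarkovKernel M := ⟨fun z => by rw [hM z]; infer_instance⟩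
  exact uniformlyErgodic_of_minorised (blockUpdate_sweep_smul_le K K' π π' hK hK' L M hL hM)
    (blockUpdate_alternate_invariant K K' π π' hKinv hK'inv L M hL hM) μ₀ t S

/-! ## §2 The flow instance: mutually trained independence samplers with bounded weights -/

variable {Ω : Type*} [MeasurableSpace Ω]

/-- The Doeblin minorisation of `IMHKernel` as a measure inequality: `(W)⁻¹ • π ≤ indepMH q w (x, ·)` for `0 < w ≤ W`. [ours, bookkeeping] -/
theorem indepMH_smul_le (q : Measure Ω) [IsProbabilityMeasure q] {w : Ω → ℝ} (hw : Measurable w) (hw0 : ∀ x, 0 < w x) {W : ℝ}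
    (hW : ∀ x, w x ≤ W) (x : Ω) :
    (ENNReal.ofReal W)⁻¹ • (q.withDensity fun y => ENNReal.ofReal (w y)) ≤ indepMH q w x := by
  rw [Measure.le_iff]
  intro B hB
  rw [Measure.smul_apply, smul_eq_mul]
  exact indepMH_apply_ge hw hw0 hW x hB

/-- **MUTUALLY TRAINED FLOW SAMPLERS CONVERGE JOINTLY AT RATE `(1 − 1/(WW'))ᵗ`**: replica 1 is updated by `indepMH q_y w_y` with the flow fitted
on replica 2's state `y` (`w_y·q_y = π`, `w_y ≤ W`), then replica 2 by `indepMH q'_x w'_x` fitted on the new replica-1 state (`w'_x·q'_x = π`,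
`w'_x ≤ W'`); from every initial law of the pair, `|μ₀(M∘ₖL)ᵗ(S) − (π ⊗ π)(S)| ≤ (1 − (WW')⁻¹)ᵗ`. [ours] -/
theorem crossReplica_sweep_uniformlyErgodic (qfam qfam' : Ω → Measure Ω) [∀ y, IsProbabilityMeasure (qfam y)]
    [∀ x, IsProbabilityMeasure (qfam' x)] (wfam wfam' : Ω → Ω → ℝ)
    (hw : ∀ y, Measurable (wfam y)) (hw0 : ∀ y x, 0 < wfam y x) (hw' : ∀ x, Measurable (wfam' x)) (hw0' : ∀ x y, 0 < wfam' x y)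
    {W W' : ℝ} (hW : ∀ y x, wfam y x ≤ W) (hW' : ∀ x y, wfam' x y ≤ W')
    (π : Measure Ω) [IsProbabilityMeasure π]
    (hπ : ∀ y, (qfam y).withDensity (fun x => ENNReal.ofReal (wfam y x)) = π)
    (hπ' : ∀ x, (qfam' x).withDensity (fun y => ENNReal.ofReal (wfam' x y)) = π)
    (K K' : Kernel (Ω × Ω) Ω) [IsMarkovKernel K] [IsMarkovKernel K'] (hK : ∀ x y, K (x, y) = indepMH (qfam y) (wfam y) x)
    (hK' : ∀ x y, K' (x, y) = indepMH (qfam' x) (wfam' x) y)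
    (L M : Kernel (Ω × Ω) (Ω × Ω)) (hL : ∀ z, L z = (K z).prod (Measure.dirac z.2)) (hM : ∀ z, M z = (Measure.dirac z.1).prod (K' z))
    (μ₀ : Measure (Ω × Ω)) [IsProbabilityMeasure μ₀] (t : ℕ) (S : Set (Ω × Ω)) :
    |((fun ν : Measure (Ω × Ω) => ν.bind (M ∘ₖ L))^[t] μ₀).real S - (π.prod π).real S| ≤ (1 - (W * W')⁻¹) ^ t := by
  obtain ⟨x₀⟩ := nonempty_of_isProbabilityMeasure π
  have hWpos : 0 < W := (hw0 x₀ x₀).trans_le (hW x₀ x₀)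
  have hW'pos : 0 < W' := (hw0' x₀ x₀).trans_le (hW' x₀ x₀)
  have hmin : ∀ z : Ω × Ω, (ENNReal.ofReal W)⁻¹ • π ≤ K z := fun z => by
    obtain ⟨x, y⟩ := z
    have h := indepMH_smul_le (qfam y) (hw y) (hw0 y) (hW y) x
    rwa [hπ y, ← hK x y] at h
  have hmin' : ∀ z : Ω × Ω, (ENNReal.ofReal W')⁻¹ • π ≤ K' z := fun z => by
    obtain ⟨x, y⟩ := z
    have h := indepMH_smul_le (qfam' x) (hw' x) (hw0' x) (hW' x) y
    rwa [hπ' x, ← hK' x y] at h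
  have hKinv : ∀ y, ∀ ⦃A : Set Ω⦄, MeasurableSet A → ∫⁻ x, K (x, y) A ∂π = π A := fun y A hA => by
    simp_rw [hK]; exact crossReplica_fibre_invariant qfam wfam hw hw0 π hπ y hA
  have hK'inv : ∀ x, ∀ ⦃B : Set Ω⦄, MeasurableSet B → ∫⁻ y, K' (x, y) B ∂π = π B := fun x B hB => by
    simp_rw [hK']; exact crossReplica_fibre_invariant qfam' wfam' hw' hw0' π hπ' x hB
  have h := blockUpdate_sweep_uniformlyErgodic K K' π π hmin hmin' hKinv hK'inv L M hL hM μ₀ t S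
  have hε : ((ENNReal.ofReal W)⁻¹ * (ENNReal.ofReal W')⁻¹).toReal = (W * W')⁻¹ := by
    rw [ENNReal.toReal_mul, ENNReal.toReal_inv, ENNReal.toReal_inv, ENNReal.toReal_ofReal hWpos.le, ENNReal.toReal_ofReal hW'pos.le,
      mul_inv]
  rwa [hε] at h

end Summit.Ventures.LatticeQCDFlow.Exactness
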